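import Summits.ResolutionOfSingularities.ResolutionOfSingularities.Theorems.HomologicalConductorNoZenoBirthDefs
import Summits.ResolutionOfSingularities.ResolutionOfSingularities.Theorems.HomologicalConductorNoZenoNoetherianCase
import HarnessLib

/-!
# Crux `NoZeno` (stmt-ResolutionOfSingularities-16483), line `birth` — stub `stub_maxDominator`

Route `ResolutionOfSingularities/HomologicalConductor`, crux
`Summit.ResolutionOfSingularities.ResolutionOfSingularities.Theses.HomologicalConductor.NoZeno`.
Registered stub of the line `birth` (`Cruxes/NoZeno/Lines/birth.lean`, skeleton v3), the WLOG-glue: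

  among the valuation rings `O' ≥ O` DOMINATING the `O`-tower of `A`
  (`T_m ⊆ O'`, and every `s ∈ T_m` with `s⁻¹ ∈ O'` already has `s⁻¹ ∈ O`)
  there is a MAXIMAL one `Om`, and every `O' > Om` fails to dominate:
  some `s ∈ T_m` has `s⁻¹ ∈ O' ∖ Om`.

Proof: Zorn (`zorn_le_nonempty₀`) on the family
`S := {O' | O ≤ O' ∧ ∀ m, ∀ s ∈ T_m, s ∈ O' ∧ (s⁻¹ ∈ O' → s⁻¹ ∈ O)}`, which contains `O`
(`T_m ⊆ O`, `mem_valuationSubring_of_mem_tower`). A non-empty chain `c ⊆ S` is bounded in `S` by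
its union, realised as `ValuationSubring.ofLE O (sSup (toSubring '' c))` (an overring of a
valuation ring is a valuation ring); membership in the `sSup` of the directed family is membership
in some member (`Subring.mem_sSup_of_directedOn`), so `s⁻¹` in the union lies in some dominator,
hence in `O`. For `O' > Om`, maximality gives `O' ∉ S` while `O ≤ O'`, so domination fails at some
`s ∈ T_m`; as `s ∈ O ⊆ O'` this means `s⁻¹ ∈ O'` and `s⁻¹ ∉ O`, and `s⁻¹ ∉ Om` since `Om`
dominates.
-/

noncomputable section

-- single-problem summit: the doubled namespace component `ResolutionOfSingularities` is forced
set_option linter.dupNamespace false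

namespace Summit.ResolutionOfSingularities.ResolutionOfSingularities.Theorems.NoZeno.Birth

open Summit.ResolutionOfSingularities.ResolutionOfSingularities.Theses.HomologicalConductor

/-! ## Chains of valuation subrings -/

/-- The union of a non-empty chain of valuation subrings above `O` is a valuation subring above
`O` bounding the chain, and each of its elements lies in some member of the chain: it is
`ValuationSubring.ofLE O (sSup (toSubring '' c))`, membership by
`Subring.mem_sSup_of_directedOn`. [folklore] -/
theorem exists_valuationSubring_sUnion_of_isChain {K : Type} [Field K] (O : ValuationSubring K)
    {c : Set (ValuationSubring K)} (hc : IsChain (· ≤ ·) c) (hO : ∀ O' ∈ c, O ≤ O')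
    (hne : c.Nonempty) :
    ∃ U : ValuationSubring K, O ≤ U ∧ (∀ O' ∈ c, O' ≤ U) ∧
      ∀ x : K, x ∈ U → ∃ O' ∈ c, x ∈ O' := by
  obtain ⟨y, hy⟩ := hne
  set c' : Set (Subring K) := ValuationSubring.toSubring '' c with hc'
  have hne' : c'.Nonempty := ⟨y.toSubring, y, hy, rfl⟩
  have hdir : DirectedOn (· ≤ ·) c' :=
    (hc.image_of_map_rel (· ≤ ·) (· ≤ ·) ValuationSubring.toSubring fun _ _ h => h).directedOn
  have hmem : ∀ O' ∈ c, O'.toSubring ≤ sSup c' := fun O' hO' => le_sSup ⟨O', hO', rfl⟩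
  have hOle : O.toSubring ≤ sSup c' := fun x hx => hmem y hy ((hO y hy) hx)
  refine ⟨ValuationSubring.ofLE O (sSup c') hOle, fun x hx => hOle hx,
    fun O' hO' x hx => hmem O' hO' hx, fun x hx => ?_⟩
  obtain ⟨R, ⟨O', hO'c, rfl⟩, hxR⟩ := (Subring.mem_sSup_of_directedOn hne' hdir).mp hx
  exact ⟨O', hO'c, hxR⟩

/-! ## The registered stub -/

/-- **STUB `stub_maxDominator` (line `birth` of crux `NoZeno`, skeleton v3 glue).** Among the
valuation rings `O' ≥ O` dominating the `O`-tower of `A` (`T_m ⊆ O'`, and `O'`-units of `T_m`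
are `O`-units) there is a MAXIMAL one `Om`: the family is non-empty (`O`, as `T_m ⊆ O` by
`mem_valuationSubring_of_mem_tower`), and the union of a chain of dominators is a valuation ring
(`exists_valuationSubring_sUnion_of_isChain`) that dominates; Zorn (`zorn_le_nonempty₀`).
Maximality unfolds to: every `O' > Om` fails to dominate, i.e. some `s ∈ T_m` has
`s⁻¹ ∈ O' ∖ Om`. [cite: ZariskiSamuel1960, VI §5] -/
theorem stub_maxDominator (k K : Type) [Field k] [Field K] [Algebra k K]
    (O : ValuationSubring K) (A : Subalgebra k K) (hk : ∀ c : k, algebraMap k K c ∈ O)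
    (hAO : A.toSubring ≤ O.toSubring) :
    ∃ Om : ValuationSubring K, O ≤ Om ∧
      (∀ m : ℕ, ∀ s ∈ tower O A m, s ∈ Om ∧ (s⁻¹ ∈ Om → s⁻¹ ∈ O)) ∧
      ∀ O' : ValuationSubring K, Om < O' → ∃ m : ℕ, ∃ s ∈ tower O A m, s⁻¹ ∈ O' ∧ s⁻¹ ∉ Om := by
  classical
  -- every stage of the tower lies in `O`
  have hT : ∀ (m : ℕ) (s : K), s ∈ tower O A m → s ∈ O :=
    mem_valuationSubring_of_mem_tower O hk hAO
  -- the family of dominators of the `O`-tower above `O`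
  set S : Set (ValuationSubring K) :=
    {O' | O ≤ O' ∧ ∀ m : ℕ, ∀ s ∈ tower O A m, s ∈ O' ∧ (s⁻¹ ∈ O' → s⁻¹ ∈ O)} with hS
  have hOS : O ∈ S := ⟨le_rfl, fun m s hs => ⟨hT m s hs, id⟩⟩
  -- chains in `S` are bounded in `S` by their union
  have hchain : ∀ c ⊆ S, IsChain (· ≤ ·) c → ∀ y ∈ c, ∃ ub ∈ S, ∀ z ∈ c, z ≤ ub := by
    intro c hcS hc y hy
    obtain ⟨U, hOU, hcU, hUc⟩ := exists_valuationSubring_sUnion_of_isChain O hc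
      (fun O' hO' => (hcS hO').1) ⟨y, hy⟩
    refine ⟨U, ⟨hOU, fun m s hs => ⟨hOU (hT m s hs), fun hinv => ?_⟩⟩, hcU⟩
    obtain ⟨O', hO'c, hinv'⟩ := hUc s⁻¹ hinv
    exact ((hcS hO'c).2 m s hs).2 hinv'
  -- a maximal dominator
  obtain ⟨Om, hOOm, hmax⟩ := zorn_le_nonempty₀ S hchain O hOS
  refine ⟨Om, hOOm, hmax.prop.2, fun O' hlt => ?_⟩
  -- `O' > Om` is not a dominator, although `O ≤ O'`
  have hO'S : O' ∉ S := fun h => (lt_iff_le_not_ge.1 hlt).2 (hmax.2 h hlt.le)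
  have hdom : ¬ ∀ m : ℕ, ∀ s ∈ tower O A m, s ∈ O' ∧ (s⁻¹ ∈ O' → s⁻¹ ∈ O) :=
    fun h => hO'S ⟨hOOm.trans hlt.le, h⟩
  push Not at hdom
  obtain ⟨m, s, hs, hfail⟩ := hdom
  have hsO' : s ∈ O' := hlt.le (hOOm (hT m s hs))
  obtain ⟨hinvO', hninvO⟩ := hfail hsO'
  exact ⟨m, s, hs, hinvO', fun h => hninvO ((hmax.prop.2 m s hs).2 h)⟩

end Summit.ResolutionOfSingularities.ResolutionOfSingularities.Theorems.NoZeno.Birth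

end
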